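import Summits.QuantumFields.YangMills.Theorems.BalabanUVNodesN16AveragingPin
import Summits.QuantumFields.BalabanUV.T4Continuum.Support.NE3SpreadLiftCurlCorner
import Summits.QuantumFields.BalabanUV.T4Continuum.Support.NE3SpreadLiftCurlLocal
import Literature.MathematicalPhysics.QuantumFieldTheory.Balaban1983to89.MatrixLogLipschitz
import Literature.Analysis.Complex.RungeUnits
import HarnessLib

/-!
# YM-DAG node N16 (NE3), the located averaging pin (42) ↔ (0.4) — part 30: ONE-STEP LIPSCHITZ CONTROL OF (42) IN BONDWISE OPERATOR NORM between a `U(N)`-valued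
# competitor and a small-field configuration — the analytic input of part 29's (43)-target induction that the tree CAN supply, supplied

Cell `pub-ymgap`, width seat `pub-ymgap-dag-n16-w3` (director-ym №197 ∕ HUMAN RULING D-0149), generation 9; part 30 of the W1b lineage.  INDEPENDENT of parts 27–29
(imports g0's `…N16AveragingPin` for `step42`, pub-balaban's unitary bookkeeping `NE3SpreadLiftCurlCorner`∕`…Local`, lit-balaban's `MatrixLogLipschitz` and
`Literature.Analysis.Complex.RungeUnits`); part 29's `LipschitzNear d (step42 L) 1 {U(N)-valued} (sfClass …) η₀ Λ₁` is the packaging of §4 (done there).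
`--kind proof --supports stmt-QuantumFields-27366 --as helper` (K3⁸, KEY MAP v2; count-neutral; 0 `def`).  `bears_on: R4∕N16`.

THE ESTIMATE (elementary; [Balaban1985Averaging] (42) p. 23 read in operator norm).  `V̄(c) = exp[L^{−d} Σ_{x∈B(c₋)} log(V(Γ_{c,x})V(c)⁻¹)]·V(c)`.  For `U(N)`-valued `V, V′` with
`‖V(b) − V′(b)‖ ≤ η` at every bond:
 * §1 `norm_stepHol_sub_le`, ★ `norm_hol_sub_hol_le` — parallel transports along a word `w` differ by `≤ |w|·η` (products of unitaries are `1`-Lipschitz in each factor: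
   pub-balaban's `norm_mul_sub_mul_le`, `norm_inv_sub_inv_eq`); `norm_Wcx_sub_Wcx_le` — the loop variables `V(Γ_{c,x})V(c)⁻¹` differ by `≤ (2|x−c₋|₁ + 2L)·η ≤ (2dL + 2L)·η`.
 * §2 ON THE GUARD `‖V′(Γ_{c,x})V′(c)⁻¹ − 1‖ ≤ 1∕4` with `(2dL + 2L)·η ≤ 1∕4` (so both loop variables lie in the ball of radius `1∕2` where the series log is `2`-Lipschitz,
   `MatrixLogLipschitz.norm_mlog_sub_mlog_le`): `norm_Xavg_sub_Xavg_le` — `‖X_c(V) − X_c(V′)‖ ≤ 2(2dL + 2L)·η`; `norm_Xavg_le_one` — `‖X_c‖ ≤ 1` for both.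
 * §3 ★★ `norm_bavg_sub_bavg_le` — `‖V̄(c) − V̄′(c)‖ ≤ e·(4dL + 5L)·η` (exp is `e`-Lipschitz on the unit ball, `Literature.Analysis.Complex.norm_exp_sub_exp_le`; `V(c)` unitary;
   `‖e^{X′}‖ ≤ e`); `norm_step42_sub_step42_le` — the same for the rescaled one-step (43)-iterate `step42 L = rescale L ∘ bavg L` at every bond.
 * §4 THE SMALL-FIELD READING: for a `U(N)`-valued `V′` in `SmallField V′ α` with `512(d+1)(d+4)L²α ≤ 1` (pub-balaban's class radius; lit-balaban's `B7Prop2Explicit.norm_Wcx_sub_one_le`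
   puts every loop variable of `V′` within `16(d+1)(d+4)L²α ≤ 1∕32 ≤ 1∕4` of `1`) and every `U(N)`-valued `V` with `‖V − V′‖_bond ≤ η ≤ 1∕(8(d+1)L)`:
   ★★ `norm_step42_sub_step42_le_of_smallField` — `‖step42 L V (q,κ) − step42 L V′ (q,κ)‖ ≤ e(4d+5)L·η` at every coarse bond.  Members of `sfClass d L N ε k` are such `V′`
   (radius `ε∕(L^k)² ≤ ε`), `sfClass_smallField_of_le`.
READING (honest).  This is the ONE-STEP Lipschitz constant `Λ₁ = e(4d+5)L` of (42)∕(43) near the small-field class with competitor class «`U(N)`-valued» and radius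
`η₀ = 1∕(8(d+1)L)`; the `k`-fold constant of part 29's `LipschitzNear d (step42 L) k …` follows by composing along the (43)-orbit, which stays small-field by [Balaban1985Averaging]
Prop. 2 (pub-balaban's `MinimalActionCompact.avgIter_unitary_smallField_two`) — composed in part 31, not here.  No claim about the (0.4) scheme of record.
RELATED IN THE TREE (cited, not duplicated).  lit-balaban's `B7Eq65AverageLipschitz.norm_bavg_sub_bavg_le` (pub-balaban NE9 leaf-04 lineage) is the same phenomenon in a
DIFFERENT currency: a GENERAL unit-bounded base `V′` with `1∕128`-regular block loops, an ARBITRARY competitor `V` in multiplicative closeness `‖V(b)V′(b)⁻¹ − 1‖ ≤ δ ≤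
1∕(12288(d+1)L)`, constant `26384(d+1)L`, proved through [Balaban1985Averaging] Prop. 7's analyticity (`B7Prop7OneStep`); its `norm_avgIter_sub_avgIter_le` iterates along (43)
under ε′-SMALL BONDS of the base's level averages (an axial-gauge currency).  The present file serves N16's class `sfClass` — BOTH configurations `U(N)`-valued, the base
small-PLAQUETTE (gauge-invariant), additive bondwise closeness, radius `1∕(8(d+1)L)`, constant `e(4d+5)L` — by the elementary log∕exp-Lipschitz route; neither statement
implies the other as typed.

HONEST FRAMING.  [folklore] elementary operator-norm bookkeeping over lit-balaban's (42) (`B7Prop1Explicit.bavg ∕ Xavg ∕ Wcx ∕ hol`), its guard lemma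
`B7Prop2Explicit.norm_Wcx_sub_one_le` ([Balaban1985Averaging] p. 25), `MatrixLogLipschitz`, `RungeUnits.norm_exp_sub_exp_le`, and pub-balaban's unitary lemmas; 0 `def`, 0 `sorry`,
no `instance`, no `notation`; nothing of [Balaban1985Averaging]'s Propositions is asserted beyond the cited kernel theorem; K3⁸ stubs `stub_rates13HV` ∕ `stub_expansion13HV` NOT
touched; N16 ∕ NE3 NOT discharged; count-neutral (typed 28∕28 · discharged 5∕27 work-bound, A 5∕28 — unmoved).  One finite four-torus programme at fixed `ε` — the Yang–Mills
mass gap (Clay) is NOT proved by any of this; R4 closes the conditional finite-𝕋⁴ rung `BalabanLadder.UV` only; nothing continuum ∕ ℝ⁴ ∕ OS.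
-/

set_option autoImplicit false

open scoped BigOperators Matrix Matrix.Norms.L2Operator
open NormedSpace

namespace Summit.QuantumFields.YangMills.BalabanUVNodes.N16Eq42LipschitzSmallField

open Literature.MathematicalPhysics.QuantumFieldTheory.Balaban1983to89
open B7Prop1Explicit B7Prop2Explicit
open T4AveragingDeficitWall (IsUnitaryCfg SmallField)
open Summit.QuantumFields.BalabanUV.T4Continuum
open MinimalActionRate (sfClass)
open NE3SpreadLiftCurlCorner (norm_mul_sub_mul_le norm_inv_sub_inv_eq)
open NE3SpreadLiftCurlLocal (hol_unitary)
open AveragingDeficitTransport (mem_U1_of_unitary)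
open Summit.QuantumFields.YangMills.BalabanUVNodes.N16AveragingPin (step42)

noncomputable section

variable {d : ℕ} {n : Type*} [Fintype n] [DecidableEq n]

/-! ## §1 Parallel transports and loop variables are Lipschitz in the bond variables (unitary case) -/

section Hol

variable {V V' : Site d → Fin d → (Matrix n n ℂ)ˣ} {η : ℝ} (hV : IsUnitaryCfg V) (hV' : IsUnitaryCfg V')
  (hnear : ∀ (x : Site d) (i : Fin d), ‖((V x i : (Matrix n n ℂ)ˣ) : Matrix n n ℂ) - ((V' x i : (Matrix n n ℂ)ˣ) : Matrix n n ℂ)‖ ≤ η)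
include hV hV' hnear

/-- One letter: `‖V(b) − V′(b)‖ ≤ η` for forward letters, `‖V(b)⁻¹ − V′(b)⁻¹‖ = ‖V(b) − V′(b)‖ ≤ η` for backward ones (unitarity). [folklore] -/
theorem norm_stepHol_sub_le (x : Site d) (l : Letter d) :
    ‖((stepHol V x l : (Matrix n n ℂ)ˣ) : Matrix n n ℂ) - ((stepHol V' x l : (Matrix n n ℂ)ˣ) : Matrix n n ℂ)‖ ≤ η := by
  obtain ⟨μ, b⟩ := l
  cases b
  · simp only [stepHol, Bool.false_eq_true, ↓reduceIte]
    rw [norm_inv_sub_inv_eq (hV _ _) (hV' _ _)]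
    exact hnear _ _
  · simp only [stepHol, ↓reduceIte]
    exact hnear _ _

/-- **★ PARALLEL TRANSPORTS ARE `|w|`-LIPSCHITZ**: `‖V(Γ) − V′(Γ)‖ ≤ |w|·η` along every word `w` (telescoping products of unitaries). [folklore] -/
theorem norm_hol_sub_hol_le : ∀ (x : Site d) (w : List (Letter d)),
    ‖((hol V x w : (Matrix n n ℂ)ˣ) : Matrix n n ℂ) - ((hol V' x w : (Matrix n n ℂ)ˣ) : Matrix n n ℂ)‖ ≤ w.length * η
  | x, [] => by simp
  | x, l :: w => by
    rw [hol_cons, hol_cons, List.length_cons, Nat.cast_succ]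
    refine (norm_mul_sub_mul_le (stepHol_mem_of hV x l) (hol_unitary hV' _ w)).trans ?_
    have h1 := norm_stepHol_sub_le hV hV' hnear x l
    have h2 := norm_hol_sub_hol_le (x + l.vec) w
    linarith

variable (L : ℕ)

/-- **THE LOOP VARIABLES OF (42) ARE LIPSCHITZ**: `‖V(Γ_{c,x})V(c)⁻¹ − V′(Γ_{c,x})V′(c)⁻¹‖ ≤ (2|x − c₋|₁ + 2L)·η`. [folklore] -/
theorem norm_Wcx_sub_Wcx_le (q : Site d) (κ : Fin d) (r : Site d) :
    ‖((Wcx L V q κ r : (Matrix n n ℂ)ˣ) : Matrix n n ℂ) - ((Wcx L V' q κ r : (Matrix n n ℂ)ˣ) : Matrix n n ℂ)‖ ≤ (2 * l1 r + 2 * L) * η := by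
  unfold Wcx
  refine (norm_mul_sub_mul_le (hol_unitary hV _ _) ((unitaryUnits _).inv_mem (hol_unitary hV' _ _))).trans ?_
  rw [norm_inv_sub_inv_eq (hol_unitary hV _ _) (hol_unitary hV' _ _)]
  refine (add_le_add (norm_hol_sub_hol_le hV hV' hnear q _) (norm_hol_sub_hol_le hV hV' hnear q _)).trans ?_
  rw [length_gammaWord, length_seg, Int.natAbs_natCast]
  push_cast
  ring_nf
  rfl

/-- … on the block: `|x − c₋|₁ ≤ dL`, so `≤ (2dL + 2L)·η`. [folklore] -/
theorem norm_Wcx_sub_Wcx_le_box (hη : 0 ≤ η) (q : Site d) (κ : Fin d) (r : Fin d → Fin L) :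
    ‖((Wcx L V q κ (boxVec L r) : (Matrix n n ℂ)ˣ) : Matrix n n ℂ) - ((Wcx L V' q κ (boxVec L r) : (Matrix n n ℂ)ˣ) : Matrix n n ℂ)‖
      ≤ (2 * (d * L) + 2 * L) * η := by
  refine (norm_Wcx_sub_Wcx_le hV hV' hnear L q κ _).trans (mul_le_mul_of_nonneg_right ?_ hη)
  have h := l1_boxVec_le L r
  have : ((l1 (boxVec L r) : ℕ) : ℝ) ≤ (d * L : ℕ) := by exact_mod_cast h
  push_cast at this
  linarith

end Hol

section GuardBound

variable (L : ℕ)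

/-- On the guard both exponents have norm `≤ 1` (each log has norm `≤ 2·(1∕2)`, `MatrixLog.norm_mlog_le_two_mul`). [folklore] -/
theorem norm_Xavg_le_one_of_guard {W : Site d → Fin d → (Matrix n n ℂ)ˣ}
    (hW : ∀ (q : Site d) (κ : Fin d) (r : Fin d → Fin L), ‖((Wcx L W q κ (boxVec L r) : (Matrix n n ℂ)ˣ) : Matrix n n ℂ) - 1‖ ≤ 1 / 2)
    (q : Site d) (κ : Fin d) : ‖Xavg L W q κ‖ ≤ 1 := by
  unfold Xavg
  have hterm : ∀ r : Fin d → Fin L,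
      ‖((L : ℝ) ^ d)⁻¹ • MatrixLog.mlog ((Wcx L W q κ (boxVec L r) : (Matrix n n ℂ)ˣ) : Matrix n n ℂ)‖ ≤ ((L : ℝ) ^ d)⁻¹ * 1 := by
    intro r
    rw [norm_smul, Real.norm_of_nonneg (by positivity)]
    refine mul_le_mul_of_nonneg_left ?_ (by positivity)
    have := MatrixLog.norm_mlog_le_two_mul (hW q κ r)
    linarith [hW q κ r]
  refine (norm_sum_le _ _).trans ((Finset.sum_le_sum fun r _ => hterm r).trans ?_)
  rw [Finset.sum_const, Finset.card_univ, nsmul_eq_mul, mul_one]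
  by_cases hL : L = 0
  · subst hL
    by_cases hd : d = 0
    · subst hd; simp
    · have : Fintype.card (Fin d → Fin 0) = 0 := by
        rw [Fintype.card_fun, Fintype.card_fin, Fintype.card_fin]; exact zero_pow hd
      rw [this]; simp
  · have hLpos : (0 : ℝ) < (L : ℝ) ^ d := by positivity
    rw [Fintype.card_fun, Fintype.card_fin, Fintype.card_fin, Nat.cast_pow, mul_inv_cancel₀ hLpos.ne']

end GuardBound

/-! ## §2 On the guard: the exponents of (42) are `2(2dL + 2L)`-Lipschitz and bounded by `1` -/

section Guard

variable (L : ℕ) {V V' : Site d → Fin d → (Matrix n n ℂ)ˣ} {η : ℝ} (hV : IsUnitaryCfg V) (hV' : IsUnitaryCfg V')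
  (hnear : ∀ (x : Site d) (i : Fin d), ‖((V x i : (Matrix n n ℂ)ˣ) : Matrix n n ℂ) - ((V' x i : (Matrix n n ℂ)ˣ) : Matrix n n ℂ)‖ ≤ η)
  (hη : 0 ≤ η) (hηs : (2 * (d * L) + 2 * L) * η ≤ 1 / 4)
  (hguard : ∀ (q : Site d) (κ : Fin d) (r : Fin d → Fin L), ‖((Wcx L V' q κ (boxVec L r) : (Matrix n n ℂ)ˣ) : Matrix n n ℂ) - 1‖ ≤ 1 / 4)
include hV hV' hnear hη hηs hguard

/-- The competitor's loop variables are on the wider guard `≤ 1∕2` (triangle). [folklore] -/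
theorem norm_Wcx_sub_one_le_half (q : Site d) (κ : Fin d) (r : Fin d → Fin L) :
    ‖((Wcx L V q κ (boxVec L r) : (Matrix n n ℂ)ˣ) : Matrix n n ℂ) - 1‖ ≤ 1 / 2 := by
  have h1 := norm_Wcx_sub_Wcx_le_box hV hV' hnear L hη q κ r
  have h2 := hguard q κ r
  calc ‖((Wcx L V q κ (boxVec L r) : (Matrix n n ℂ)ˣ) : Matrix n n ℂ) - 1‖
      ≤ ‖((Wcx L V q κ (boxVec L r) : (Matrix n n ℂ)ˣ) : Matrix n n ℂ) - ((Wcx L V' q κ (boxVec L r) : (Matrix n n ℂ)ˣ) : Matrix n n ℂ)‖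
          + ‖((Wcx L V' q κ (boxVec L r) : (Matrix n n ℂ)ˣ) : Matrix n n ℂ) - 1‖ := norm_sub_le_norm_sub_add_norm_sub _ _ _
    _ ≤ 1 / 4 + 1 / 4 := add_le_add (h1.trans hηs) h2
    _ = 1 / 2 := by norm_num

/-- **THE EXPONENTS ARE LIPSCHITZ**: `‖X_c(V) − X_c(V′)‖ ≤ 2(2dL + 2L)·η` (the block mean of `2`-Lipschitz logs of `(2dL+2L)`-Lipschitz loop variables). [folklore] -/
theorem norm_Xavg_sub_Xavg_le (q : Site d) (κ : Fin d) :
    ‖Xavg L V q κ - Xavg L V' q κ‖ ≤ 2 * ((2 * (d * L) + 2 * L) * η) := by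
  unfold Xavg
  rw [← Finset.sum_sub_distrib]
  have hterm : ∀ r : Fin d → Fin L,
      ‖(((L : ℝ) ^ d)⁻¹ • MatrixLog.mlog ((Wcx L V q κ (boxVec L r) : (Matrix n n ℂ)ˣ) : Matrix n n ℂ)
          - ((L : ℝ) ^ d)⁻¹ • MatrixLog.mlog ((Wcx L V' q κ (boxVec L r) : (Matrix n n ℂ)ˣ) : Matrix n n ℂ))‖
        ≤ ((L : ℝ) ^ d)⁻¹ * (2 * ((2 * (d * L) + 2 * L) * η)) := by
    intro r
    rw [← smul_sub, norm_smul, Real.norm_of_nonneg (by positivity)]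
    refine mul_le_mul_of_nonneg_left ?_ (by positivity)
    have hlog := MatrixLogLipschitz.norm_mlog_sub_mlog_le (r := 1 / 2) (by norm_num)
      (norm_Wcx_sub_one_le_half L hV hV' hnear hη hηs hguard q κ r) ((hguard q κ r).trans (by norm_num))
    refine hlog.trans ?_
    rw [div_le_iff₀ (by norm_num)]
    have h1 := norm_Wcx_sub_Wcx_le_box hV hV' hnear L hη q κ r
    linarith
  refine (norm_sum_le _ _).trans ((Finset.sum_le_sum fun r _ => hterm r).trans ?_)
  rw [Finset.sum_const, Finset.card_univ, nsmul_eq_mul]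
  -- the number of block sites is `L^d`; if `L = 0` (no block sites unless `d = 0`) the sum is still bounded
  by_cases hL : L = 0
  · subst hL
    by_cases hd : d = 0
    · subst hd
      simp
    · have : Fintype.card (Fin d → Fin 0) = 0 := by
        rw [Fintype.card_fun, Fintype.card_fin, Fintype.card_fin]
        exact zero_pow hd
      rw [this]
      simp only [Nat.cast_zero, zero_mul]
      positivity
  · have hLpos : (0 : ℝ) < (L : ℝ) ^ d := by positivity
    rw [Fintype.card_fun, Fintype.card_fin, Fintype.card_fin, Nat.cast_pow, ← mul_assoc, mul_inv_cancel₀ hLpos.ne', one_mul]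

end Guard

/-! ## §3 (42) and its rescaled iterate `step42` are Lipschitz in bondwise operator norm -/

section Avg

variable [Nonempty n] (L : ℕ) {V V' : Site d → Fin d → (Matrix n n ℂ)ˣ} {η : ℝ} (hV : IsUnitaryCfg V) (hV' : IsUnitaryCfg V')
  (hnear : ∀ (x : Site d) (i : Fin d), ‖((V x i : (Matrix n n ℂ)ˣ) : Matrix n n ℂ) - ((V' x i : (Matrix n n ℂ)ˣ) : Matrix n n ℂ)‖ ≤ η)
  (hη : 0 ≤ η) (hηs : (2 * (d * L) + 2 * L) * η ≤ 1 / 4)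
  (hguard : ∀ (q : Site d) (κ : Fin d) (r : Fin d → Fin L), ‖((Wcx L V' q κ (boxVec L r) : (Matrix n n ℂ)ˣ) : Matrix n n ℂ) - 1‖ ≤ 1 / 4)
include hV hV' hnear hη hηs hguard

/-- **★★ (42) IS LIPSCHITZ**: `‖V̄(c) − V̄′(c)‖ ≤ e·(4dL + 5L)·η` at every coarse bond `c = ⟨q, q + Le_κ⟩` (`V̄ = e^{X}·V(c)`: `exp` is `e`-Lipschitz on the unit ball, `V(c)` is unitary,
`‖e^{X′}‖ ≤ e`, and `V(c) = V(Γ_c)` is `L`-Lipschitz). [folklore] -/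
theorem norm_bavg_sub_bavg_le (q : Site d) (κ : Fin d) :
    ‖((bavg L V q κ : (Matrix n n ℂ)ˣ) : Matrix n n ℂ) - ((bavg L V' q κ : (Matrix n n ℂ)ˣ) : Matrix n n ℂ)‖ ≤ Real.exp 1 * (4 * (d * L) + 5 * L) * η := by
  have hX : ‖Xavg L V q κ‖ ≤ 1 :=
    norm_Xavg_le_one_of_guard L (norm_Wcx_sub_one_le_half L hV hV' hnear hη hηs hguard) q κ
  have hX' : ‖Xavg L V' q κ‖ ≤ 1 :=
    norm_Xavg_le_one_of_guard L (fun q κ r => (hguard q κ r).trans (by norm_num)) q κ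
  have hdX := norm_Xavg_sub_Xavg_le L hV hV' hnear hη hηs hguard q κ
  have hseg := norm_hol_sub_hol_le hV hV' hnear q (seg κ L)
  rw [length_seg, Int.natAbs_natCast] at hseg
  -- `e^X h − e^{X'} h' = (e^X − e^{X'}) h + e^{X'} (h − h')`
  have e1 : ((bavg L V q κ : (Matrix n n ℂ)ˣ) : Matrix n n ℂ) - ((bavg L V' q κ : (Matrix n n ℂ)ˣ) : Matrix n n ℂ)
      = (exp (Xavg L V q κ) - exp (Xavg L V' q κ)) * ((hol V q (seg κ L) : (Matrix n n ℂ)ˣ) : Matrix n n ℂ)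
        + exp (Xavg L V' q κ) * (((hol V q (seg κ L) : (Matrix n n ℂ)ˣ) : Matrix n n ℂ) - ((hol V' q (seg κ L) : (Matrix n n ℂ)ˣ) : Matrix n n ℂ)) := by
    simp only [bavg, Units.val_mul, val_expUnit, sub_mul, mul_sub]
    abel
  rw [e1]
  have hexp : ‖exp (Xavg L V q κ) - exp (Xavg L V' q κ)‖ ≤ 2 * ((2 * (d * L) + 2 * L) * η) * Real.exp 1 := by
    refine (Literature.Analysis.Complex.norm_exp_sub_exp_le _ _).trans ?_
    exact mul_le_mul hdX (Real.exp_le_exp.mpr (max_le hX hX')) (by positivity) (by positivity)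
  have hexp' : ‖exp (Xavg L V' q κ)‖ ≤ Real.exp 1 :=
    (Literature.Analysis.Complex.norm_exp_le_exp_norm _).trans (Real.exp_le_exp.mpr hX')
  calc ‖(exp (Xavg L V q κ) - exp (Xavg L V' q κ)) * ((hol V q (seg κ L) : (Matrix n n ℂ)ˣ) : Matrix n n ℂ)
        + exp (Xavg L V' q κ) * (((hol V q (seg κ L) : (Matrix n n ℂ)ˣ) : Matrix n n ℂ) - ((hol V' q (seg κ L) : (Matrix n n ℂ)ˣ) : Matrix n n ℂ))‖
      ≤ ‖exp (Xavg L V q κ) - exp (Xavg L V' q κ)‖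
        + ‖exp (Xavg L V' q κ)‖ * ‖((hol V q (seg κ L) : (Matrix n n ℂ)ˣ) : Matrix n n ℂ) - ((hol V' q (seg κ L) : (Matrix n n ℂ)ˣ) : Matrix n n ℂ)‖ := by
        refine (norm_add_le _ _).trans (add_le_add ?_ (norm_mul_le _ _))
        rw [CStarRing.norm_mul_mem_unitary _ (mem_unitaryUnits.mp (hol_unitary hV q _))]
    _ ≤ 2 * ((2 * (d * L) + 2 * L) * η) * Real.exp 1 + Real.exp 1 * (L * η) :=
        add_le_add hexp (mul_le_mul hexp' hseg (by positivity) (by positivity))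
    _ = Real.exp 1 * (4 * (d * L) + 5 * L) * η := by ring

/-- **THE ONE-STEP (43)-ITERATE `step42 L = rescale L ∘ bavg L` IS LIPSCHITZ AT EVERY BOND** (rescaling reads a sub-family of the coarse bonds). [folklore] -/
theorem norm_step42_sub_step42_le (x : Site d) (κ : Fin d) :
    ‖((step42 L V x κ : (Matrix n n ℂ)ˣ) : Matrix n n ℂ) - ((step42 L V' x κ : (Matrix n n ℂ)ˣ) : Matrix n n ℂ)‖ ≤ Real.exp 1 * (4 * (d * L) + 5 * L) * η := by
  show ‖((rescale L (bavg L V) x κ : (Matrix n n ℂ)ˣ) : Matrix n n ℂ) - ((rescale L (bavg L V') x κ : (Matrix n n ℂ)ˣ) : Matrix n n ℂ)‖ ≤ _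
  rw [rescale_apply, rescale_apply]
  exact norm_bavg_sub_bavg_le L hV hV' hnear hη hηs hguard _ κ

end Avg

/-! ## §4 The small-field reading: the guard from pub-balaban's class radius, the Lipschitz constant `e(4d+5)L` within radius `1∕(8(d+1)L)` -/

section SmallFieldReading

variable [Nonempty n] {L : ℕ} (hL : 1 ≤ L) {V V' : Site d → Fin d → (Matrix n n ℂ)ˣ} {η α : ℝ}
include hL

/-- **THE GUARD FROM THE SMALL-FIELD RADIUS**: a `U(N)`-valued `V′` with `SmallField V′ α`, `0 ≤ α`, `512(d+1)(d+4)L²α ≤ 1` has every loop variable of (42) within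
`16(d+1)(d+4)L²α ≤ 1∕32` of `1` ([Balaban1985Averaging] p. 25, lit-balaban's `B7Prop2Explicit.norm_Wcx_sub_one_le`), in particular within `1∕4`. [folklore] -/
theorem guard_of_smallField (hV' : IsUnitaryCfg V') (hα : 0 ≤ α) (hsmall : 512 * (d + 1) * (d + 4) * (L : ℝ) ^ 2 * α ≤ 1) (hsf : SmallField V' α)
    (q : Site d) (κ : Fin d) (r : Fin d → Fin L) :
    ‖((Wcx L V' q κ (boxVec L r) : (Matrix n n ℂ)ˣ) : Matrix n n ℂ) - 1‖ ≤ 1 / 4 := by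
  have h := norm_Wcx_sub_one_le L hL V' (fun x κ => mem_U1_of_unitary (hV' x κ)) hα hsmall
    (fun x κ κ' hκ => hsf x κ κ' hκ) q κ r
  refine h.trans ?_
  have hd : (0 : ℝ) ≤ (d : ℝ) := by positivity
  nlinarith [hsmall, hα, sq_nonneg (L : ℝ)]

/-- **★★ ONE-STEP LIPSCHITZ CONTROL OF (43) NEAR THE SMALL-FIELD CONFIGURATIONS**: `V, V′` `U(N)`-valued, `SmallField V′ α` with `0 ≤ α`, `512(d+1)(d+4)L²α ≤ 1`, and
`‖V(b) − V′(b)‖ ≤ η` at every bond with `0 ≤ η`, `8(d+1)L·η ≤ 1` ⇒ `‖step42 L V (b′) − step42 L V′ (b′)‖ ≤ e(4d+5)L·η` at every coarse bond `b′`. [folklore] -/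
theorem norm_step42_sub_step42_le_of_smallField (hV : IsUnitaryCfg V) (hV' : IsUnitaryCfg V')
    (hnear : ∀ (x : Site d) (i : Fin d), ‖((V x i : (Matrix n n ℂ)ˣ) : Matrix n n ℂ) - ((V' x i : (Matrix n n ℂ)ˣ) : Matrix n n ℂ)‖ ≤ η)
    (hη : 0 ≤ η) (hη8 : 8 * (d + 1) * (L : ℝ) * η ≤ 1)
    (hα : 0 ≤ α) (hsmall : 512 * (d + 1) * (d + 4) * (L : ℝ) ^ 2 * α ≤ 1) (hsf : SmallField V' α) (x : Site d) (κ : Fin d) :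
    ‖((step42 L V x κ : (Matrix n n ℂ)ˣ) : Matrix n n ℂ) - ((step42 L V' x κ : (Matrix n n ℂ)ˣ) : Matrix n n ℂ)‖ ≤ Real.exp 1 * ((4 * d + 5) * L) * η := by
  have hηs : (2 * (d * L) + 2 * L) * η ≤ 1 / 4 := by nlinarith
  have h := norm_step42_sub_step42_le L hV hV' hnear hη hηs (guard_of_smallField hL hV' hα hsmall hsf) x κ
  refine h.trans (le_of_eq ?_)
  ring

omit [Nonempty n] in
/-- Members of pub-balaban's small-field class `sfClass d L N ε k` (radius `ε∕(L^k)²`) are `U(N)`-valued and in `SmallField · ε` whenever `0 ≤ ε`, `1 ≤ L` (the radius only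
shrinks with the depth). [folklore] -/
theorem smallField_of_mem_sfClass {N k : ℕ} {ε : ℝ} (hε : 0 ≤ ε) {U : Site d → Fin d → (Matrix n n ℂ)ˣ} (hU : U ∈ sfClass d L N ε k) :
    IsUnitaryCfg U ∧ SmallField U ε := by
  refine ⟨hU.1, MinimalActionRate.SmallField.mono hU.2.2 ?_⟩
  have hLk : (1 : ℝ) ≤ ((L : ℝ) ^ k) ^ 2 := one_le_pow₀ (one_le_pow₀ (by exact_mod_cast hL))
  exact div_le_self hε hLk

/-- **★★ THE CLASS FORM**: for every member `V′` of `sfClass d L N ε k` (`0 ≤ ε`, `512(d+1)(d+4)L²ε ≤ 1`) and every `U(N)`-valued `V` with `‖V − V′‖_bond ≤ η`, `0 ≤ η`,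
`8(d+1)L·η ≤ 1`: `‖step42 L V − step42 L V′‖_bond ≤ e(4d+5)L·η` — the `k = 1`, competitor-class-`U(N)` instance of part 29's `LipschitzNear` for (43), in raw form. [folklore] -/
theorem norm_step42_sub_step42_le_of_mem_sfClass {N k : ℕ} {ε : ℝ} (hε : 0 ≤ ε) (hsmall : 512 * (d + 1) * (d + 4) * (L : ℝ) ^ 2 * ε ≤ 1)
    (hV : IsUnitaryCfg V) (hV' : V' ∈ sfClass d L N ε k)
    (hnear : ∀ (x : Site d) (i : Fin d), ‖((V x i : (Matrix n n ℂ)ˣ) : Matrix n n ℂ) - ((V' x i : (Matrix n n ℂ)ˣ) : Matrix n n ℂ)‖ ≤ η)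
    (hη : 0 ≤ η) (hη8 : 8 * (d + 1) * (L : ℝ) * η ≤ 1) (x : Site d) (κ : Fin d) :
    ‖((step42 L V x κ : (Matrix n n ℂ)ˣ) : Matrix n n ℂ) - ((step42 L V' x κ : (Matrix n n ℂ)ˣ) : Matrix n n ℂ)‖ ≤ Real.exp 1 * ((4 * d + 5) * L) * η := by
  obtain ⟨hV'u, hV'sf⟩ := smallField_of_mem_sfClass hL hε hV'
  exact norm_step42_sub_step42_le_of_smallField hL hV hV'u hnear hη hη8 hε hsmall hV'sf x κ

end SmallFieldReading

end

end Summit.QuantumFields.YangMills.BalabanUVNodes.N16Eq42LipschitzSmallField
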